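import Literature.MathematicalPhysics.QuantumFieldTheory.Balaban1983to89.B11Prop6Scheme

/-!
# `Balaban1983to89.B11Eq176Expansion` — [Balaban1985Variational] Sect. G, p. 306, (176): «the expansion of 𝒜₁ in H₁B …
# begins with a term of second order … 𝒜₁^{(2)} = −𝔊((δ/δA′)V^{(3)})(H₁B)» — PROVED in the abstract Banach-space scheme of
# `B11Prop6Scheme` (the solution of (175) is O(|H₁B|²) and agrees with −𝔊((δ/δA′)V)(H₁B) to third order)

statement-level skeleton of published theorems with citation tags; proofs where landed; nothing here is a claim about the Yang–Mills mass gap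

CITATION HEADER (lean-in-tree rule 2026-08-18).  T. Bałaban, *The variational problem and background fields in
renormalization group method for lattice gauge theories*, Commun. Math. Phys. **102**, 277–309 (1985),
doi:10.1007/bf01229381 [Balaban1985Variational] (cell paper B11; held `paper:balaban1985-cmp102-variational-background`,
journal page = PDF page + 276).  Render `…/1985-cmp102-variational-background-p030-x2.png` (p. 306) READ AS AN IMAGE by
this seat (lit-balaban reader/typer r08, 2026-08-20); p. 305 (174)–(175) from the render-verified transcript
`run/shared/lean/pub/pub-balaban/b2b-balaban-b11/transcript.md`.

THE PRINT (pp. 305–306 [PDF 29–30], verbatim).  *«The configuration 𝓗 is represented as 𝓗 = 𝒜₁ + H₁B − HD(𝒜₁ + H₁B),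
(174) where 𝒜₁ satisfies the equation 𝒜₁ + 𝔊((δ/δA′)V)(𝒜₁ + H₁B) = 0, (175) …»* *«The function 𝒜₁, as a solution of
Eq. (175), is an analytic function of H₁B, hence of B. An expansion of 𝒜₁ in H₁B can be obtained again by taking an
expansion of ((δ/δA′)V)(A′) in A′, substituting it in (175) together with the unknown expansion of 𝒜₁, and then solving a
recursive system of equations. Let us notice that it begins with a term of second order in H₁B, more exactly we have
𝒜₁^{(2)} = −𝔊((δ/δA′)V^{(3)})(H₁B). (176) This implies that the expansion of 𝓗 begins with the first order term H₁B. Let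
us write first and second order terms in it 𝓗 = H₁B − 𝔊((δ/δA′)V^{(3)})(H₁B) − HC^{(2)}(H₁B) + ⋯. (177)»*

WHAT IS PROVED HERE (Mathlib + the tree module `B11Prop6Scheme` BY NAME; abstract complex Banach spaces as there).
Equation (175) is `B11Prop6Scheme.mapT 𝒢 0 W 0 𝔄` (J = 0, no linear term) with `W = (δ/δA′)V` (hypothesis
`QuadAnalytic W C₄ a₃` = Prop. 4) and `𝔄 = H₁B`, `‖𝔄‖ < a`.  For its solution `X` in the ball `‖X‖ ≤ ε₄` (Prop. 6):
* `norm_solution_le_sq` — **second order**: `‖X‖ ≤ B₀C₄(ε₄ + a)²` (so with the admissible choice ε₄ ≍ a², `X = O(|H₁B|²)`: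
  *«it begins with a term of second order in H₁B»*);
* `norm_solution_add_le` — **(176), third-order agreement**: `‖X + 𝒢(W 𝔄)‖ ≤ 4B₀C₄(ε₄ + a)·‖X‖ ≤ 4B₀²C₄²(ε₄ + a)³`, i.e.
  the second-order part of `X` is that of `−𝔊((δ/δA′)V)(H₁B)`; and if `W` agrees with its quadratic part `W₂ =
  (δ/δA′)V^{(3)}` to third order (`‖W Y − W₂ Y‖ ≤ C′‖Y‖³`, the paper's V = V^{(3)} + V₄, (29)), then
  `‖X + 𝒢(W₂ 𝔄)‖ ≤ 4B₀²C₄²(ε₄ + a)³ + B₀C′a³` (`norm_solution_add_quadratic_le`) — the printed (176).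
(177) is then (174) read to second order; the term −HC^{(2)}(H₁B) comes from D^{(2)} = C^{(2)} ((56)) and is not
re-derived here.  NOT modelled: the operators 𝔊, H, D of [5]/[15] and the identification W₂ = (δ/δA′)V^{(3)}.
Unit `lit-balaban-r08` (row B11.Eq174 / r08.83 of `HOME/lit-balaban-r08/ROWS-B11.md`).
-/

namespace Literature.MathematicalPhysics.QuantumFieldTheory.Balaban1983to89.B11Eq176Expansion

open Literature.MathematicalPhysics.QuantumFieldTheory.Balaban1983to89.B13Contraction113 (QuadAnalytic)
open Literature.MathematicalPhysics.QuantumFieldTheory.Balaban1983to89.B11Prop6Scheme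

variable {𝒴 𝒵 : Type*} [NormedAddCommGroup 𝒴] [NormedSpace ℂ 𝒴] [NormedAddCommGroup 𝒵] [NormedSpace ℂ 𝒵]
variable {𝒢 : 𝒵 →L[ℂ] 𝒴} {W : 𝒴 → 𝒵} {B₀ C₄ a₃ : ℝ}

/-- **Second order** (p. 306 *«it begins with a term of second order in H₁B»*): a solution `X` of (175) (fixed point of
`X ↦ −𝒢 W(X + 𝔄)`) in the ball `‖X‖ ≤ ε₄`, with `‖𝔄‖ < a`, `ε₄ + a ≤ a₃`, satisfies `‖X‖ ≤ B₀C₄(ε₄ + a)²`.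
[cite: Balaban1985Variational, (175)–(176) pp.305–306] -/
theorem norm_solution_le_sq (h𝒢 : ∀ f, ‖𝒢 f‖ ≤ B₀ * ‖f‖) (hW : QuadAnalytic W C₄ a₃) (hB₀ : 0 ≤ B₀) (hC₄ : 0 ≤ C₄)
    {𝔄 : 𝒴} {a ε₄ : ℝ} (h𝔄 : ‖𝔄‖ < a) (hdom : ε₄ + a ≤ a₃) {X : 𝒴} (hX : ‖X‖ ≤ ε₄)
    (hfix : mapT 𝒢 0 W 0 𝔄 X = X) : ‖X‖ ≤ B₀ * C₄ * (ε₄ + a) ^ 2 := by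
  have hm : ‖X + 𝔄‖ < ε₄ + a := norm_arg_lt h𝔄 hX
  have hΛ : ∀ Y : 𝒴, ‖(0 : 𝒴 →L[ℂ] 𝒴) Y‖ ≤ 0 * ‖Y‖ := fun Y => by simp
  have h := bound_117 (Λ := 0) (θ := 0) (J := (0 : 𝒵)) h𝒢 hΛ hW hB₀ (hm.trans_le hdom)
  rw [hfix, norm_zero, mul_zero, zero_mul, zero_add, zero_add] at h
  exact h.trans (mul_le_mul_of_nonneg_left (pow_le_pow_left₀ (norm_nonneg _) hm.le 2) (mul_nonneg hB₀ hC₄))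

/-- **(176), third-order agreement**: for the same solution, `‖X + 𝒢(W 𝔄)‖ ≤ 4B₀C₄(ε₄ + a)‖X‖` — the fixed point differs
from the first iterate `−𝒢 W(𝔄) = T(0)` by the contraction constant (119)–(120) times `‖X − 0‖`; with
`norm_solution_le_sq` this is `≤ 4B₀²C₄²(ε₄ + a)³`. Requires `2(ε₄ + a) ≤ a₃` as in (121).
[cite: Balaban1985Variational, (176) p.306] -/
theorem norm_solution_add_le (h𝒢 : ∀ f, ‖𝒢 f‖ ≤ B₀ * ‖f‖) (hW : QuadAnalytic W C₄ a₃) (hB₀ : 0 ≤ B₀)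
    (hC₄ : 0 ≤ C₄) {𝔄 : 𝒴} {a ε₄ : ℝ} (h𝔄 : ‖𝔄‖ < a) (hε₄ : 0 ≤ ε₄) (hdom : 2 * (ε₄ + a) ≤ a₃) {X : 𝒴}
    (hX : ‖X‖ ≤ ε₄) (hfix : mapT 𝒢 0 W 0 𝔄 X = X) :
    ‖X + 𝒢 (W 𝔄)‖ ≤ 4 * B₀ * C₄ * (ε₄ + a) * ‖X‖ ∧
      ‖X + 𝒢 (W 𝔄)‖ ≤ 4 * B₀ ^ 2 * C₄ ^ 2 * (ε₄ + a) ^ 3 := by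
  have hΛ : ∀ Y : 𝒴, ‖(0 : 𝒴 →L[ℂ] 𝒴) Y‖ ≤ 0 * ‖Y‖ := fun Y => by simp
  have hL := lipschitz_120 (Λ := 0) (θ := 0) (J := (0 : 𝒵)) h𝒢 hΛ hW hB₀ hC₄ h𝔄 hε₄ hdom hX
    (X₂ := 0) (by simpa using hε₄)
  rw [hfix, mapT_158, zero_add, sub_zero, zero_add, sub_neg_eq_add] at hL
  have ha : 0 < a := (norm_nonneg _).trans_lt h𝔄
  have hdom' : ε₄ + a ≤ a₃ := by linarith
  have hsq := norm_solution_le_sq h𝒢 hW hB₀ hC₄ h𝔄 hdom' hX hfix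
  refine ⟨hL, hL.trans ?_⟩
  have hK : 0 ≤ 4 * B₀ * C₄ * (ε₄ + a) := by
    have : 0 ≤ ε₄ + a := by linarith
    positivity
  calc 4 * B₀ * C₄ * (ε₄ + a) * ‖X‖ ≤ 4 * B₀ * C₄ * (ε₄ + a) * (B₀ * C₄ * (ε₄ + a) ^ 2) :=
        mul_le_mul_of_nonneg_left hsq hK
    _ = 4 * B₀ ^ 2 * C₄ ^ 2 * (ε₄ + a) ^ 3 := by ring

/-- **(176) as printed, `𝒜₁^{(2)} = −𝔊((δ/δA′)V^{(3)})(H₁B)`**: if `W` agrees with a map `W₂` (its quadratic part,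
(δ/δA′)V^{(3)}) up to a cubic error `‖W Y − W₂ Y‖ ≤ C′‖Y‖³` on `‖Y‖ < a₃`, then the solution agrees with `−𝒢(W₂ 𝔄)` up to
third order: `‖X + 𝒢(W₂ 𝔄)‖ ≤ 4B₀²C₄²(ε₄ + a)³ + B₀C′a³`. [cite: Balaban1985Variational, (176) p.306] -/
theorem norm_solution_add_quadratic_le (h𝒢 : ∀ f, ‖𝒢 f‖ ≤ B₀ * ‖f‖) (hW : QuadAnalytic W C₄ a₃) (hB₀ : 0 ≤ B₀)
    (hC₄ : 0 ≤ C₄) {W₂ : 𝒴 → 𝒵} {C' : ℝ} (hC' : 0 ≤ C')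
    (hW₂ : ∀ Y : 𝒴, ‖Y‖ < a₃ → ‖W Y - W₂ Y‖ ≤ C' * ‖Y‖ ^ 3) {𝔄 : 𝒴} {a ε₄ : ℝ} (h𝔄 : ‖𝔄‖ < a)
    (hε₄ : 0 ≤ ε₄) (hdom : 2 * (ε₄ + a) ≤ a₃) {X : 𝒴} (hX : ‖X‖ ≤ ε₄) (hfix : mapT 𝒢 0 W 0 𝔄 X = X) :
    ‖X + 𝒢 (W₂ 𝔄)‖ ≤ 4 * B₀ ^ 2 * C₄ ^ 2 * (ε₄ + a) ^ 3 + B₀ * C' * a ^ 3 := by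
  have h1 := (norm_solution_add_le h𝒢 hW hB₀ hC₄ h𝔄 hε₄ hdom hX hfix).2
  have ha3 : ‖𝔄‖ < a₃ := by
    have ha : 0 < a := (norm_nonneg _).trans_lt h𝔄
    linarith
  have h2 : ‖𝒢 (W 𝔄) - 𝒢 (W₂ 𝔄)‖ ≤ B₀ * C' * a ^ 3 := by
    rw [← map_sub]
    calc ‖𝒢 (W 𝔄 - W₂ 𝔄)‖ ≤ B₀ * ‖W 𝔄 - W₂ 𝔄‖ := h𝒢 _
      _ ≤ B₀ * (C' * ‖𝔄‖ ^ 3) := mul_le_mul_of_nonneg_left (hW₂ 𝔄 ha3) hB₀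
      _ ≤ B₀ * (C' * a ^ 3) := by
          refine mul_le_mul_of_nonneg_left (mul_le_mul_of_nonneg_left ?_ hC') hB₀
          exact pow_le_pow_left₀ (norm_nonneg _) h𝔄.le 3
      _ = B₀ * C' * a ^ 3 := by ring
  have e : X + 𝒢 (W₂ 𝔄) = (X + 𝒢 (W 𝔄)) - (𝒢 (W 𝔄) - 𝒢 (W₂ 𝔄)) := by abel
  rw [e]
  exact (norm_sub_le _ _).trans (add_le_add h1 h2)

end Literature.MathematicalPhysics.QuantumFieldTheory.Balaban1983to89.B11Eq176Expansion
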